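import Mathlib.FieldTheory.IsAlgClosed.AlgebraicClosure
import Mathlib.LinearAlgebra.Finsupp.LinearCombination
import Mathlib.LinearAlgebra.Quotient.Basic
import Literature.AlgebraicGeometry.Motives.RelativePeriods
import HarnessLib

-- provenance: harness21/H21/H21/Statements/Periods/Sweep1.lean @ 853bf94 (interim HEAD d8f2665); M5 mechanical rewrite
/-!
# Statement sweep 1 for the family `periods`: Kontsevich's formal period conjecture

This file records **periods.S02**, Kontsevich's *formal* period conjecture
(Kontsevich 1999, §4; Kontsevich–Zagier 2001, §4.1; Huber–Müller-Stach 2017, Def. 13.1.1 and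
Conj. 13.1.9): the space `𝒫̃⁺(k)` of *effective formal periods* is generated by
symbols `(X, D, ω, γ)` — `(X, D)` a pair of `k`-varieties, `ω ∈ Hⁱ_dR(X, D)`,
`γ ∈ Hᵢ(X_σ(ℂ), D_σ(ℂ); ℚ)` — modulo (1) linearity in `ω` and in `γ`, (2) functoriality
`(X, D, f^*ω', γ) = (X', D', ω', f_*γ)` for morphisms of pairs, and (3) the boundary relation
`(Y, Z, ω, ∂γ) = (X, Y, δω, γ)` for triples `Z ⊆ Y ⊆ X`; the conjecture asserts that the
evaluation map `(X, D, ω, γ) ↦ ∫_γ ω`, `𝒫̃⁺(ℚ̄) → ℂ`, is **injective**.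

## Covered ids

* **periods.S02** : `Literature.NumberTheory.Transcendental.KontsevichPeriodConjecture` (kernel form
  `ker ev = relations` for `k = ℚ̄ = AlgebraicClosure ℚ`), with the general-`k` predicate
  `Literature.Periods.FormalPeriodEvalInjective R B σ` (a conjecture-statement, not a theorem: proved in
  print for no `k`; see its docstring), the soundness theorem
  `formalPeriodRelations_le_ker` (`relations ≤ ker ev`, Huber–Müller-Stach 2017, Prop. 13.1.5:
  `ev` is well defined) and the reformulation as injectivity on the quotient
  (`formalPeriodEvalInjective_iff_injective_liftQ`).

## Ids NOT covered, with the missing notion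

* `periods.S03` (Grothendieck period conjecture, André 2004 §7.5; Ayoub 2014 §1): needs the
  *motivic Galois group* `G_mot(X)` (Tannakian group of `⟨h(X)⟩` in André/Nori motives) as a
  linear algebraic group over `ℚ` **together with its dimension**; H21 has motivated classes
  (`WeilCohomology.motivatedClasses`, prelude C16) and the period field
  (`PeriodRealization.periodFieldOf`), but neither pure/Nori motives, nor Tannakian groups, nor
  the dimension of an algebraic subgroup of `GLₙ` (Mathlib has no linear algebraic groups).
* `periods.S04` (Huber–Müller-Stach 2017 Thm. 13.1.4, §13.2; Huber 2020 Prop. 6.1, 6.5): needs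
  Nori's diagram category / *Nori motives* `MM_Nori(k)`, Nori's period algebra `𝒫(MM_Nori)` with
  its torsor structure, and the motivic Galois group; none has a prelude.
* `periods.S25` (Brown 2012 Thm. 1.1/1.2; Deligne–Goncharov 2005): needs the Tannakian
  category `MT(ℤ)` of *mixed Tate motives over `ℤ`* and its (de Rham–Betti) period set; H21 has
  the MZV algebra (`TranscendEllArithS.MultipleZeta`) but no mixed Tate motives.
* `periods.S33` (Ayoub 2015, Ann. of Math. 181, Thm. 1.3/4.25): needs Ayoub's explicit space of
  *relative* formal periods — Laurent series in a formal variable `ϖ` with coefficients in the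
  rings `𝒪_alg(𝔻̄ⁿ)` of power series algebraic over `ℚ̄(z₁,…,zₙ)` and convergent on a
  neighbourhood of the closed polydisc, with the specialisations `zᵢ ↦ 0, 1, ϖ` — and the
  precise printed list of "obvious relations"; no prelude provides algebraic holomorphic
  functions on polydiscs, and the absolute (`ϖ`-free) analogue is conjectural (equivalent to the
  period conjecture), so a faithful statement is not possible with ≤ 40 lines of glue.

## Design notes

* We follow the *cohomological* version of Huber–Müller-Stach 2017, Def. 13.1.1 (arbitrary
  pairs of varieties and cohomological degree `i`), which they show is equivalent to Kontsevich's
  original version with top-degree logarithmic forms on smooth affine `X` and normal crossings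
  `D` (loc. cit., Rem. 13.1.2 / Thm. 13.1.4).
* Relative de Rham cohomology and the period pairing come from the accepted hypothesis structure
  `Literature.RelativePeriodData P` (prelude C10); relative singular homology of the complex points is
  honest (prelude G04). The boundary relation (3) needs the connecting morphisms of a *triple*
  `Z ⊆ Y ⊆ X` on both sides; C10 does not carry the de Rham coboundary, and identifying the
  complex points `Y_σ(ℂ)` of the scheme `Y` with the subspace `ι(Y_σ(ℂ)) ⊆ X_σ(ℂ)` (a closed
  embedding for the analytic topology) is not in the prelude either. Both connecting maps are
  therefore recorded, in the two-speed style of the trunk, as a small hypothesis structure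
  `RelativePeriodData.BoundaryData R` whose axioms are exactness of the two long exact
  sequences of the triple at the connecting maps and the compatibility
  `∫_γ δω = ∫_{∂γ} ω` (Huber–Müller-Stach 2017, Lemma 11.1.3 (2)). Consequently
  **periods.S02** is a `def … : Prop` applied to `(R, B, σ)`; for the classical data it is exactly
  Kontsevich's conjecture. It is open, so no `theorem` is asserted.
* Scalars. `Hⁱ_dR(X, D)` is a `k`-vector space and `Hᵢ(X_σ(ℂ), D_σ(ℂ); ℚ)` a `ℚ`-vector space; we
  build `𝒫̃⁺` as the free `k`-module on symbols modulo `k`-linearity in `ω` and `ℚ`-linearity in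
  `γ`, and `ev` as a `k`-linear map to `ℂ` regarded as a `k`-algebra via `σ` (`AlongHom ℂ σ`).
  Under Huber–Müller-Stach 2017, Thm. 13.1.4 (`𝒫̃⁺(ℚ̄) ≅` Nori's effective period algebra, a
  `ℚ̄`-algebra in which `∫_γ aω = a ∫_γ ω` holds formally) the `k`-linearity relations hold in
  their `𝒫̃⁺(ℚ̄)` as well, so the kernel statement below is equivalent to theirs.
* The conjecture is stated in kernel form `∀ x, ev x = 0 → x ∈ relations` (like Mathlib-style
  `RiemannHypothesis` and H21's `KZKernelConjecture`), avoiding a quotient type in the statement;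
  `formalPeriodEvalInjective_iff_injective_liftQ` gives the quotient form.
* Mathlib: searched `period`, `Kontsevich`, `formal period`, `Nori` — nothing; we use
  `Finsupp.linearCombination`, `Submodule.span`, `Submodule.liftQ`, `AlgebraicClosure ℚ`.

## References

* M. Kontsevich, *Operads and motives in deformation quantization*, Lett. Math. Phys. 48 (1999),
  §4.
* M. Kontsevich, D. Zagier, *Periods*, in Mathematics Unlimited (2001), §1.2, §4.1.
* A. Huber, S. Müller-Stach, *Periods and Nori motives*, Springer (2017), Lemma 11.1.3,
  Def. 13.1.1, Rem. 13.1.2, Thm. 13.1.4, Prop. 13.1.5, Conj. 13.1.9, §13.2.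
* J. Ayoub, *Une version relative de la conjecture des périodes de Kontsevich–Zagier*,
  Ann. of Math. 181 (2015).
* A. Hatcher, *Algebraic Topology*, CUP (2002), §2.1 (long exact sequence of a triple).
-/

open CategoryTheory AlgebraicGeometry Opposite

noncomputable section

universe u

namespace Literature.NumberTheory.Transcendental

/-! ### Triples of schemes and boundary data -/

/-- A **triple** `Z ⊆ Y ⊆ X` of `k`-schemes: closed `k`-immersions `ι_Z : Z ⟶ Y` and
`ι_Y : Y ⟶ X` (Huber–Müller-Stach 2017, Def. 13.1.1 (3) and Lemma 11.1.3 (2): the boundary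
relation of formal periods is indexed by such triples). [cite: HuberMullerStach2017, Def. 13.1.1 (3)] -/
structure SchemeTriple (k : Type u) [Field k] where
  /-- The ambient `k`-scheme `X`. -/
  X : Literature.AlgebraicGeometry.Motives.SchemeOver k
  /-- The middle closed subscheme `Y ⊆ X`. -/
  Y : Literature.AlgebraicGeometry.Motives.SchemeOver k
  /-- The smallest closed subscheme `Z ⊆ Y`. -/
  Z : Literature.AlgebraicGeometry.Motives.SchemeOver k
  /-- The inclusion `ι_Y : Y ⟶ X`. -/
  ιY : Y ⟶ X
  /-- The inclusion `ι_Z : Z ⟶ Y`. -/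
  ιZ : Z ⟶ Y
  /-- `ι_Y` is a closed immersion. -/
  isClosedImmersion_ιY : IsClosedImmersion ιY.left
  /-- `ι_Z` is a closed immersion. -/
  isClosedImmersion_ιZ : IsClosedImmersion ιZ.left

namespace SchemeTriple

variable {k : Type u} [Field k] (T : SchemeTriple k)

/-- The outer pair `(X, Y)` of a triple `Z ⊆ Y ⊆ X` (Huber–Müller-Stach 2017, Def. 13.1.1 (3)). [cite: HuberMullerStach2017, Def. 13.1.1 (3)] -/
def outer : Literature.AlgebraicGeometry.Motives.SchemePair k := ⟨T.X, T.Y, T.ιY, T.isClosedImmersion_ιY⟩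

/-- The inner pair `(Y, Z)` of a triple `Z ⊆ Y ⊆ X` (Huber–Müller-Stach 2017, Def. 13.1.1 (3)). [cite: HuberMullerStach2017, Def. 13.1.1 (3)] -/
def inner : Literature.AlgebraicGeometry.Motives.SchemePair k := ⟨T.Y, T.Z, T.ιZ, T.isClosedImmersion_ιZ⟩

attribute [instance] isClosedImmersion_ιY isClosedImmersion_ιZ

/-- The total pair `(X, Z)` of a triple `Z ⊆ Y ⊆ X`, with inclusion `ι_Z ≫ ι_Y`
(Huber–Müller-Stach 2017, Lemma 11.1.3 (2): the long exact sequence of the triple). [cite: HuberMullerStach2017, Lemma 11.1.3 (2)] -/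
def total : Literature.AlgebraicGeometry.Motives.SchemePair k :=
  ⟨T.X, T.Z, T.ιZ ≫ T.ιY, by rw [Over.comp_left]; infer_instance⟩

/-- The morphism of pairs `(Y, Z) ⟶ (X, Z)` of a triple (`f_X = ι_Y`, `f_D = 𝟙`). [folklore] -/
def innerToTotal : T.inner ⟶ T.total := ⟨T.ιY, 𝟙 T.Z, Category.id_comp _⟩

/-- The morphism of pairs `(X, Z) ⟶ (X, Y)` of a triple (`f_X = 𝟙`, `f_D = ι_Z`). [folklore] -/
def totalToOuter : T.total ⟶ T.outer := ⟨𝟙 T.X, T.ιZ, (Category.comp_id _).symm⟩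

/-- `T.outer.X = T.X` (by `rfl`). [folklore] -/
@[simp] lemma outer_X : T.outer.X = T.X := rfl

/-- `T.outer.D = T.Y` (by `rfl`). [folklore] -/
@[simp] lemma outer_D : T.outer.D = T.Y := rfl

/-- `T.inner.X = T.Y` (by `rfl`). [folklore] -/
@[simp] lemma inner_X : T.inner.X = T.Y := rfl

/-- `T.inner.D = T.Z` (by `rfl`). [folklore] -/
@[simp] lemma inner_D : T.inner.D = T.Z := rfl

end SchemeTriple

section RelativePeriodData
open Literature.AlgebraicGeometry.Motives (RelativePeriodData)
open Literature.AlgebraicGeometry.Motives.RelativePeriodData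

variable {k : Type} [Field k] [CharZero k] {P : Literature.AlgebraicGeometry.Motives.PeriodRealization k}

/-- **Boundary data** for relative period data `R`: for every triple `Z ⊆ Y ⊆ X` of `k`-schemes,
the de Rham connecting morphism `δ : Hⁱ_dR(Y, Z) → Hⁱ⁺¹_dR(X, Y)` and the Betti connecting
morphism `∂ : Hᵢ₊₁(X_σ(ℂ), Y_σ(ℂ); ℚ) → Hᵢ(Y_σ(ℂ), Z_σ(ℂ); ℚ)` of the triple, making the
sequences `Hⁱ(X, Z) → Hⁱ(Y, Z) →δ Hⁱ⁺¹(X, Y) → Hⁱ⁺¹(X, Z)` and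
`Hᵢ₊₁(X, Z) → Hᵢ₊₁(X, Y) →∂ Hᵢ(Y, Z) → Hᵢ(X, Z)` exact and subject to the compatibility
`∫_γ δω = ∫_{∂γ} ω` (Huber–Müller-Stach 2017, Lemma 11.1.3 (2), Def. 13.1.1 (3); Hatcher 2002,
§2.1, long exact sequence of a triple). A hypothesis structure: for the classical realization
these are the connecting morphisms of the long exact sequences of the triple. [cite: HuberMullerStach2017, Lemma 11.1.3 (2)] -/
structure _root_.Literature.AlgebraicGeometry.Motives.RelativePeriodData.BoundaryData (R : RelativePeriodData P) where
  /-- The de Rham coboundary `δ : Hⁱ_dR(Y, Z) →ₗ[k] Hⁱ⁺¹_dR(X, Y)` of a triple. -/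
  coboundary (T : SchemeTriple k) (i : ℕ) : R.obj T.inner i →ₗ[k] R.obj T.outer (i + 1)
  /-- The Betti boundary `∂ : Hᵢ₊₁(X_σ(ℂ), Y_σ(ℂ); ℚ) →ₗ[ℚ] Hᵢ(Y_σ(ℂ), Z_σ(ℂ); ℚ)` of a triple. -/
  boundary (σ : k →+* ℂ) (T : SchemeTriple k) (i : ℕ) :
    T.outer.bettiHomology σ (i + 1) →ₗ[ℚ] T.inner.bettiHomology σ i
  /-- Exactness of `Hⁱ_dR(X, Z) → Hⁱ_dR(Y, Z) →δ Hⁱ⁺¹_dR(X, Y)` (long exact sequence of the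
  triple in relative de Rham cohomology; Huber–Müller-Stach 2017, §3.1). -/
  exact_map_coboundary : ∀ (T : SchemeTriple k) (i : ℕ),
    Function.Exact (R.map T.innerToTotal i) (coboundary T i)
  /-- Exactness of `Hⁱ_dR(Y, Z) →δ Hⁱ⁺¹_dR(X, Y) → Hⁱ⁺¹_dR(X, Z)`. -/
  exact_coboundary_map : ∀ (T : SchemeTriple k) (i : ℕ),
    Function.Exact (coboundary T i) (R.map T.totalToOuter (i + 1))
  /-- Exactness of `Hᵢ₊₁(X, Z) → Hᵢ₊₁(X, Y) →∂ Hᵢ(Y, Z)` on complex points (long exact sequence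
  of the triple in singular homology; Hatcher 2002, §2.1). -/
  exact_map_boundary : ∀ (σ : k →+* ℂ) (T : SchemeTriple k) (i : ℕ),
    Function.Exact (Literature.AlgebraicGeometry.Motives.SchemePair.bettiHomology.map σ T.totalToOuter (i + 1)).hom (boundary σ T i)
  /-- Exactness of `Hᵢ₊₁(X, Y) →∂ Hᵢ(Y, Z) → Hᵢ(X, Z)` on complex points. -/
  exact_boundary_map : ∀ (σ : k →+* ℂ) (T : SchemeTriple k) (i : ℕ),
    Function.Exact (boundary σ T i) (Literature.AlgebraicGeometry.Motives.SchemePair.bettiHomology.map σ T.innerToTotal i).hom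
  /-- Compatibility of the period pairing with the connecting morphisms:
  `∫_γ δω = ∫_{∂γ} ω` (Huber–Müller-Stach 2017, Lemma 11.1.3 (2)). -/
  pairing_coboundary : ∀ (σ : k →+* ℂ) (T : SchemeTriple k) (i : ℕ) (ω : R.obj T.inner i)
    (γ : T.outer.bettiHomology σ (i + 1)),
      R.pairing σ T.outer (i + 1) (coboundary T i ω) γ = R.pairing σ T.inner i ω (boundary σ T i γ)

end RelativePeriodData

/-! ### Formal effective periods -/

section Periods

variable {k : Type} [Field k] [CharZero k] {P : Literature.AlgebraicGeometry.Motives.PeriodRealization k}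

/-- A **period symbol** `(X, D, ω, γ)`: a pair of `k`-varieties `Y = (X, D)`, a degree `i`, a
relative de Rham class `ω ∈ Hⁱ_dR(X, D)` and a relative Betti class
`γ ∈ Hᵢ(X_σ(ℂ), D_σ(ℂ); ℚ)`; the generators of the space of effective formal periods
(Kontsevich–Zagier 2001, §4.1; Huber–Müller-Stach 2017, Def. 13.1.1). [cite: KontsevichZagier2001, §4.1] -/
structure PeriodSymbol (R : Literature.AlgebraicGeometry.Motives.RelativePeriodData P) (σ : k →+* ℂ) where
  /-- The pair `(X, D)`. -/
  Y : Literature.AlgebraicGeometry.Motives.SchemePair k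
  /-- `(X, D)` is a pair of varieties. -/
  isVarietyPair : Y.IsVarietyPair
  /-- The (co)homological degree. -/
  i : ℕ
  /-- The de Rham class `ω ∈ Hⁱ_dR(X, D)`. -/
  ω : R.obj Y i
  /-- The Betti class `γ ∈ Hᵢ(X_σ(ℂ), D_σ(ℂ); ℚ)`. -/
  γ : Y.bettiHomology σ i

variable (R : Literature.AlgebraicGeometry.Motives.RelativePeriodData P) (B : R.BoundaryData) (σ : k →+* ℂ)

/-- The **free space of period symbols**: the free `k`-module on the symbols `(X, D, ω, γ)`
(Huber–Müller-Stach 2017, Def. 13.1.1, before imposing relations). [cite: HuberMullerStach2017, Def. 13.1.1] -/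
abbrev FreePeriodSymbols : Type 1 := PeriodSymbol R σ →₀ k

variable {R σ} in
/-- The generator `[(X, D, ω, γ)]` of the free space of period symbols. [folklore] -/
abbrev PeriodSymbol.of (s : PeriodSymbol R σ) : FreePeriodSymbols R σ := Finsupp.single s 1

variable {R σ} in
/-- The symbol `[(Y, ω, γ)]` with the pair, degree and classes given separately. [folklore] -/
abbrev periodSymbol (Y : Literature.AlgebraicGeometry.Motives.SchemePair k) (hY : Y.IsVarietyPair) (i : ℕ) (ω : R.obj Y i)
    (γ : Y.bettiHomology σ i) : FreePeriodSymbols R σ :=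
  PeriodSymbol.of ⟨Y, hY, i, ω, γ⟩

/-- The **evaluation map** `ev : (X, D, ω, γ) ↦ ∫_γ ω` on the free space of period symbols,
`k`-linear into `ℂ` regarded as a `k`-algebra via `σ` (Kontsevich–Zagier 2001, §4.1;
Huber–Müller-Stach 2017, Def. 13.1.1 / Prop. 13.1.5). [cite: KontsevichZagier2001, §4.1] -/
def formalPeriodEval : FreePeriodSymbols R σ →ₗ[k] Literature.AlgebraicGeometry.Motives.AlongHom ℂ σ :=
  Finsupp.linearCombination k fun s : PeriodSymbol R σ ↦ R.pairing σ s.Y s.i s.ω s.γ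

variable {R σ} in
/-- `ev [(X, D, ω, γ)] = ∫_γ ω` (not `simp`: it follows from `formalPeriodEval_single` and
`one_smul` since `PeriodSymbol.of` is reducible). [folklore] -/
lemma formalPeriodEval_of (s : PeriodSymbol R σ) :
    formalPeriodEval R σ (PeriodSymbol.of s) = R.pairing σ s.Y s.i s.ω s.γ := by
  simp [formalPeriodEval, Finsupp.linearCombination_single]

variable {R σ} in
/-- `ev (c · [(X, D, ω, γ)]) = c · ∫_γ ω`. [folklore] -/
@[simp]
lemma formalPeriodEval_single (s : PeriodSymbol R σ) (c : k) :
    formalPeriodEval R σ (Finsupp.single s c) = c • R.pairing σ s.Y s.i s.ω s.γ := by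
  simp [formalPeriodEval, Finsupp.linearCombination_single]

variable {R σ} in
/-- The **defining relators** of the space of effective formal periods
(Huber–Müller-Stach 2017, Def. 13.1.1; Kontsevich–Zagier 2001, §4.1):
(1) linearity in `ω` (`k`-linear) and in `γ` (`ℚ`-linear); (2) functoriality
`(X, D, f^*ω', γ) = (X', D', ω', f_*γ)` for morphisms of pairs `f`; (3) the boundary relation
`(Y, Z, ω, ∂γ) = (X, Y, δω, γ)` for triples `Z ⊆ Y ⊆ X`, with `δ`, `∂` from `B`. [cite: HuberMullerStach2017, Def. 13.1.1] -/
inductive IsFormalPeriodRelator (B : R.BoundaryData) : FreePeriodSymbols R σ → Prop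
  /-- Additivity in `ω`. -/
  | add_left (Y : Literature.AlgebraicGeometry.Motives.SchemePair k) (hY : Y.IsVarietyPair) (i : ℕ) (ω ω' : R.obj Y i)
      (γ : Y.bettiHomology σ i) :
      IsFormalPeriodRelator B
        (periodSymbol Y hY i (ω + ω') γ - periodSymbol Y hY i ω γ - periodSymbol Y hY i ω' γ)
  /-- `k`-homogeneity in `ω`. -/
  | smul_left (Y : Literature.AlgebraicGeometry.Motives.SchemePair k) (hY : Y.IsVarietyPair) (i : ℕ) (a : k) (ω : R.obj Y i)
      (γ : Y.bettiHomology σ i) :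
      IsFormalPeriodRelator B (periodSymbol Y hY i (a • ω) γ - a • periodSymbol Y hY i ω γ)
  /-- Additivity in `γ`. -/
  | add_right (Y : Literature.AlgebraicGeometry.Motives.SchemePair k) (hY : Y.IsVarietyPair) (i : ℕ) (ω : R.obj Y i)
      (γ γ' : Y.bettiHomology σ i) :
      IsFormalPeriodRelator B
        (periodSymbol Y hY i ω (γ + γ') - periodSymbol Y hY i ω γ - periodSymbol Y hY i ω γ')
  /-- `ℚ`-homogeneity in `γ`. -/
  | smul_right (Y : Literature.AlgebraicGeometry.Motives.SchemePair k) (hY : Y.IsVarietyPair) (i : ℕ) (q : ℚ) (ω : R.obj Y i)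
      (γ : Y.bettiHomology σ i) :
      IsFormalPeriodRelator B (periodSymbol Y hY i ω (q • γ) - (q : k) • periodSymbol Y hY i ω γ)
  /-- Functoriality (change of variables) along a morphism of pairs `f : (X, D) ⟶ (X', D')`. -/
  | map (Y Y' : Literature.AlgebraicGeometry.Motives.SchemePair k) (hY : Y.IsVarietyPair) (hY' : Y'.IsVarietyPair) (f : Y ⟶ Y')
      (i : ℕ) (ω' : R.obj Y' i) (γ : Y.bettiHomology σ i) :
      IsFormalPeriodRelator B
        (periodSymbol Y hY i (R.map f i ω') γ -
          periodSymbol Y' hY' i ω' ((Literature.AlgebraicGeometry.Motives.SchemePair.bettiHomology.map σ f i).hom γ))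
  /-- The boundary (Stokes) relation for a triple `Z ⊆ Y ⊆ X`. -/
  | boundary (T : SchemeTriple k) (hXY : T.outer.IsVarietyPair) (hYZ : T.inner.IsVarietyPair)
      (i : ℕ) (ω : R.obj T.inner i) (γ : T.outer.bettiHomology σ (i + 1)) :
      IsFormalPeriodRelator B
        (periodSymbol T.inner hYZ i ω (B.boundary σ T i γ) -
          periodSymbol T.outer hXY (i + 1) (B.coboundary T i ω) γ)

/-- The **submodule of relations** of effective formal periods: the `k`-span of the defining
relators. The space of effective formal periods `𝒫̃⁺(k)` of Huber–Müller-Stach 2017,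
Def. 13.1.1 is the quotient `FreePeriodSymbols R σ ⧸ formalPeriodRelations R B σ`. [cite: HuberMullerStach2017, Def. 13.1.1] -/
def formalPeriodRelations : Submodule k (FreePeriodSymbols R σ) :=
  Submodule.span k {x | IsFormalPeriodRelator B x}

/-- Soundness: every relator evaluates to `0`, i.e. `relations ≤ ker ev`, so that `ev` descends
to the space of effective formal periods (Huber–Müller-Stach 2017, Prop. 13.1.5; from bilinearity
and naturality of the period pairing, `RelativePeriodData.pairing_map`, and
`BoundaryData.pairing_coboundary`). [cite: HuberMullerStach2017, Prop. 13.1.5] -/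
theorem formalPeriodRelations_le_ker :
    formalPeriodRelations R B σ ≤ LinearMap.ker (formalPeriodEval R σ) := by
  refine Submodule.span_le.mpr ?_
  rintro x hx
  simp only [SetLike.mem_coe, LinearMap.mem_ker]
  induction hx with
  | add_left Y hY i ω ω' γ => simp [map_add, LinearMap.add_apply]
  | smul_left Y hY i a ω γ => simp [map_smul, LinearMap.smul_apply, formalPeriodEval_single]
  | add_right Y hY i ω γ γ' => simp [map_add]
  | smul_right Y hY i q ω γ =>
    simp only [map_sub, map_smul, formalPeriodEval_of]
    rw [Rat.cast_smul_eq_qsmul, sub_self]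
  | map Y Y' hY hY' f i ω' γ => simp [Literature.AlgebraicGeometry.Motives.RelativePeriodData.pairing_map_apply]
  | boundary T hXY hYZ i ω γ => simp [B.pairing_coboundary]

/-- The **formal period conjecture over `k`**, as a *predicate* on relative period data `R`,
boundary data `B` and an embedding `σ : k →+* ℂ` (a conjecture-statement, not a theorem): the
evaluation map is injective on effective formal periods, in kernel form — every formal
`k`-combination of symbols `(X, D, ω, γ)` with `∑ ∫_γ ω = 0` lies in the span of the defining
relators. Huber–Müller-Stach 2017 define `𝒫̃⁺(k)` and `ev` for every subfield `k ⊆ ℂ`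
(Def. 13.1.1) but assert injectivity only as a conjecture and only for `k/ℚ` algebraic (§13.2,
the Period Conjecture of Kontsevich–Zagier — Conj. 12.2.1 of the 2015 preprint of Part III —
where all algebraic `k` give the same `𝒫̃(k)`; "for more general fields see Ayoub's remarks");
it is open (Huber–Wüstholz 2022, Conj. 13.1; proved in cohomological degree `≤ 1` only,
loc. cit. Thm. 13.3). The instance `k = ℚ̄` is `KontsevichPeriodConjecture` (periods.S02), so no
`FormalPeriodEvalInjective_holds` can exist short of settling periods.S02; consumers take
`(h : FormalPeriodEvalInjective R B σ)` as a hypothesis (the binders `R B σ` are explicit in the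
signature so that the declaration reads as the predicate it is).
[cite: HuberMullerStach2017, Def. 13.1.1 and §13.2] -/
def FormalPeriodEvalInjective (R : Literature.AlgebraicGeometry.Motives.RelativePeriodData P) (B : R.BoundaryData) (σ : k →+* ℂ) :
    Prop :=
  ∀ x : FreePeriodSymbols R σ, formalPeriodEval R σ x = 0 → x ∈ formalPeriodRelations R B σ

/-- The kernel form is equivalent to injectivity of `ev` on the quotient
`𝒫̃⁺ = FreePeriodSymbols ⧸ relations` (Huber–Müller-Stach 2017, §13.1: "`ev` is injective"). [cite: HuberMullerStach2017, §13.1 and §13.2] -/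
theorem formalPeriodEvalInjective_iff_injective_liftQ :
    FormalPeriodEvalInjective R B σ ↔
      Function.Injective ((formalPeriodRelations R B σ).liftQ (formalPeriodEval R σ)
        (formalPeriodRelations_le_ker R B σ)) := by
  rw [← LinearMap.ker_eq_bot, Submodule.ker_liftQ, ← LinearMap.le_ker_iff_map, Submodule.ker_mkQ]
  exact ⟨fun h x hx ↦ h x hx, fun h x hx ↦ h hx⟩

/-- Every cohomological period `∫_γ ω` (prelude C10, `R.cohomologicalPeriods σ`) is a value of
`ev` on a symbol; in particular, under `CohomologicalPeriodsEqStatement` (periods.S34, file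
`CohomologicalPeriods.lean`), `ev` maps onto the Kontsevich–Zagier periods (Huber–Müller-Stach
2017, Prop. 13.1.5: `ev : 𝒫̃⁺(ℚ̄) → 𝒫⁺` is surjective). [folklore] -/
theorem cohomologicalPeriods_subset_range_formalPeriodEval :
    R.cohomologicalPeriods σ ⊆ Literature.AlgebraicGeometry.Motives.AlongHom.equiv σ '' Set.range (formalPeriodEval R σ) := by
  rintro x ⟨Y, hY, i, ω, γ, rfl⟩
  exact ⟨_, ⟨periodSymbol Y hY i ω γ, rfl⟩, by simp⟩

/-! ### periods.S02 -/

/-- **periods.S02** (Kontsevich's formal period conjecture; Kontsevich 1999, §4;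
Kontsevich–Zagier 2001, §4.1; Huber–Müller-Stach 2017, Def. 13.1.1 / Conj. 13.1.9). Let
`ℚ̄ = AlgebraicClosure ℚ` and `σ : ℚ̄ →+* ℂ`. The evaluation map
`(X, D, ω, γ) ↦ ∫_γ ω` from the space `𝒫̃⁺(ℚ̄)` of effective formal periods — symbols
`(X, D, ω, γ)` with `(X, D)` a pair of `ℚ̄`-varieties, `ω ∈ Hⁱ_dR(X, D)`,
`γ ∈ Hᵢ(X_σ(ℂ), D_σ(ℂ); ℚ)`, modulo linearity, functoriality for morphisms of pairs and the
boundary relation for triples — to `ℂ` is injective; equivalently, every formal combination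
with vanishing total period is a combination of the defining relators. Stated for relative
period data `R` with boundary data `B` over a period realization of `ℚ̄` (hypothesis
structures). The resulting `Prop` depends on the chosen `B` (the axioms of `BoundaryData` do
not determine `δ`, `∂` uniquely); the intended instance is the classical de Rham/Betti data
with `B` given by the connecting morphisms of the two long exact sequences of a triple
`Z ⊆ Y ⊆ X` (relative algebraic de Rham cohomology, resp. relative singular homology of the
complex points), for which this is exactly Kontsevich's conjecture. Open. [cite: Kontsevich1999, §4] -/
def KontsevichPeriodConjecture {P : Literature.AlgebraicGeometry.Motives.PeriodRealization (AlgebraicClosure ℚ)}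
    (R : Literature.AlgebraicGeometry.Motives.RelativePeriodData P) (B : R.BoundaryData) (σ : AlgebraicClosure ℚ →+* ℂ) : Prop :=
  FormalPeriodEvalInjective R B σ

/-- **periods.S02** (unfolding). The formal period conjecture says: `ev x = 0` implies `x` is a
relation (Huber–Müller-Stach 2017, §13.1). [cite: HuberMullerStach2017, §13.1] -/
lemma kontsevichPeriodConjecture_iff {P : Literature.AlgebraicGeometry.Motives.PeriodRealization (AlgebraicClosure ℚ)}
    (R : Literature.AlgebraicGeometry.Motives.RelativePeriodData P) (B : R.BoundaryData) (σ : AlgebraicClosure ℚ →+* ℂ) :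
    KontsevichPeriodConjecture R B σ ↔
      ∀ x : FreePeriodSymbols R σ, formalPeriodEval R σ x = 0 → x ∈ formalPeriodRelations R B σ :=
  Iff.rfl

end Periods

end Literature.NumberTheory.Transcendental

end
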